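import Summits.MatrixMultiplication.MatrixMultiplication.Theorems.LevelGradedCohnUmansLevelOneGL2DesignsTraceLiftTangency
import Summits.MatrixMultiplication.MatrixMultiplication.Theorems.LevelGradedCohnUmansLevelOneGL2DesignsStubTangencySetsHermitianReduction

/-!
# Tangency sets of size `p^{13/10}` in `AG(2,p)` for the primes `p ≡ 1 (mod 11)` — Pohoata's theorem at `r = 11`
(wall-breaker axis `parabola lifts over finite fields`, stub `stub_tangencySets` of the crux `LevelOneGL2Designs`,
stmt-MatrixMultiplication-14080, file 4/4)

Assembly of the degree-5 trace-zero lift (`…TraceLiftOrder`, `…TraceLiftNorm`, `…TraceLiftTangency`):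

* `exists_eval₂_minpoly_eq_zero` — for `p ≡ 1 (mod 11)` the minimal polynomial `f` of `2cos(2π/11)` has a root in
  `ZMod p`, namely `ζ + ζ⁻¹` for `ζ` of multiplicative order `11` (`X⁵·f(X + X⁻¹) = Φ₁₁(X)`), so there is a ring map
  `ℤ[2cos(2π/11)] → ZMod p` (`p` splits completely in `ℚ(ζ₁₁)⁺`);
* `exists_tangencySet_card_ge` — **for every prime `p ≡ 1 (mod 11)` with `p > 7023·138⁵`, an affine tangency set of
  `AG(2,p)` with `≥ p^{13/10} / (1024·7023·138⁵)^{13/10}` points** (parameters `M = 2^k` maximal with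
  `7023·138⁵·M¹⁰ < p`, `L = M²`, size `M¹³`);
* `stubFormat_exponent_thirteen_tenths` — the stub's exact flag format with `p^{3/2}` replaced by `p^{13/10}`
  (Dirichlet for the progression `1 mod 11`, then `srs_of_tangencySet`).

No notation, no definitions.  This is Theorem 1.3 of Pohoata (arXiv:2607.20422, 2026) for `r = 11`: `IM(2,p) ≳ p^{3/2 − 2/(r−1)} = p^{13/10}`,
kernel-checked — exponent `1.3`, beyond the quadratic digit lift's `5/4` (`…TangencyQuadraticLiftAllPrimes`), for a
set of primes of density `1/10`; the first formalisation of the trace-zero number-field lift.  The stub itself asks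
for exponent `3/2`.  Elementary given parts 1–3.
[cite: Pohoata2026SharpExponentMinimalDistance, Thm. 1.3, Prop. 5.1]
-/

-- the summit/problem path `MatrixMultiplication.MatrixMultiplication` is fixed by the tree layout (D-0017)
set_option linter.dupNamespace false

noncomputable section

open Polynomial Finset Matrix

namespace Summit.MatrixMultiplication.MatrixMultiplication.Theorems.LevelOneGL2Designs.TraceLift

variable {p : ℕ} [Fact p.Prime]

/-- **`p ≡ 1 (mod 11)` splits in `ℚ(ζ₁₁)⁺`**: then `f` has a root in `ZMod p`, namely `θ = ζ + ζ⁻¹` for a unit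
`ζ` of order `11` (which exists as `11 ∣ p − 1` and `(ZMod p)ˣ` is cyclic); indeed `ζ⁵·f(ζ + ζ⁻¹) =
1 + ζ + ⋯ + ζ¹⁰ = 0`. [elementary] -/
theorem exists_eval₂_minpoly_eq_zero (hmod : p % 11 = 1) :
    ∃ θ : ZMod p, eval₂ (Int.castRingHom (ZMod p)) θ (X ^ 5 + X ^ 4 - 4 * X ^ 3 - 3 * X ^ 2 + 3 * X + 1 : ℤ[X]) = 0 := by
  have hp := (Fact.out : p.Prime)
  -- a unit of order 11
  obtain ⟨g, hg⟩ := IsCyclic.exists_generator (α := (ZMod p)ˣ)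
  have hord : orderOf g = p - 1 := by
    rw [orderOf_eq_card_of_forall_mem_zpowers hg, Nat.card_eq_fintype_card, ZMod.card_units]
  have h11 : 11 ∣ p - 1 := ⟨p / 11, by omega⟩
  have hp1 : p - 1 ≠ 0 := by have := hp.two_le; omega
  set u : (ZMod p)ˣ := g ^ ((p - 1) / 11) with hu
  have hne : (p - 1) / 11 ≠ 0 := by
    intro h0
    have := Nat.div_mul_cancel h11
    rw [h0, zero_mul] at this
    exact hp1 this.symm
  have hou : orderOf u = 11 := by
    rw [hu, orderOf_pow' g hne, hord, Nat.gcd_eq_right (Nat.div_dvd_of_dvd h11), Nat.div_div_self h11 hp1]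
  set ζ : ZMod p := (u : ZMod p) with hζ
  have hζ11 : ζ ^ 11 = 1 := by
    have := pow_orderOf_eq_one u
    rw [hou] at this
    rw [hζ, ← Units.val_pow_eq_pow_val, this, Units.val_one]
  have hζ1 : ζ ≠ 1 := by
    intro h1
    have hu1 : u = 1 := Units.ext (by rw [← hζ, h1, Units.val_one])
    rw [hu1, orderOf_one] at hou
    norm_num at hou
  have hζ0 : ζ ≠ 0 := by rw [hζ]; exact Units.ne_zero u
  -- the geometric sum vanishes
  have hgeom : ∑ i ∈ Finset.range 11, ζ ^ i = 0 := by
    have h := geom_sum_mul ζ 11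
    rw [hζ11, sub_self] at h
    exact (mul_eq_zero.mp h).resolve_right (sub_ne_zero.mpr hζ1)
  refine ⟨ζ + ζ⁻¹, ?_⟩
  have key : ζ ^ 5 * ((ζ + ζ⁻¹) ^ 5 + (ζ + ζ⁻¹) ^ 4 - 4 * (ζ + ζ⁻¹) ^ 3 - 3 * (ζ + ζ⁻¹) ^ 2 +
      3 * (ζ + ζ⁻¹) + 1) = ∑ i ∈ Finset.range 11, ζ ^ i := by
    simp only [Finset.sum_range_succ, Finset.sum_range_zero]
    field_simp
    ring
  rw [hgeom] at key
  have hf : (ζ + ζ⁻¹) ^ 5 + (ζ + ζ⁻¹) ^ 4 - 4 * (ζ + ζ⁻¹) ^ 3 - 3 * (ζ + ζ⁻¹) ^ 2 + 3 * (ζ + ζ⁻¹) + 1 = 0 :=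
    (mul_eq_zero.mp key).resolve_left (pow_ne_zero 5 hζ0)
  simp only [eval₂_add, eval₂_sub, eval₂_mul, eval₂_pow, eval₂_X, eval₂_ofNat, eval₂_one]
  exact hf

/-- Exponent bookkeeping: `x¹³ ≤ V` and `p ≤ C·x¹⁰` give `p^{13/10} ≤ C^{13/10}·V`. [elementary] -/
theorem rpow_thirteen_tenths_le {q V x C : ℕ} (hx : x ^ 13 ≤ V) (hq : q ≤ C * x ^ 10) :
    (q : ℝ) ^ (13 / 10 : ℝ) ≤ (C : ℝ) ^ (13 / 10 : ℝ) * V := by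
  have h1 : (q : ℝ) ≤ C * (x : ℝ) ^ 10 := by exact_mod_cast hq
  have h2 : (x : ℝ) ^ 13 ≤ V := by exact_mod_cast hx
  have h3 : (q : ℝ) ^ (13 / 10 : ℝ) ≤ ((C : ℝ) * (x : ℝ) ^ 10) ^ (13 / 10 : ℝ) :=
    Real.rpow_le_rpow (by positivity) h1 (by norm_num)
  have h4 : ((C : ℝ) * (x : ℝ) ^ 10) ^ (13 / 10 : ℝ) = (C : ℝ) ^ (13 / 10 : ℝ) * (x : ℝ) ^ 13 := by
    rw [Real.mul_rpow (by positivity) (by positivity)]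
    congr 1
    rw [show ((x : ℝ) ^ 10) = (x : ℝ) ^ ((10 : ℕ) : ℝ) from (Real.rpow_natCast _ 10).symm,
      ← Real.rpow_mul (by positivity),
      show ((10 : ℕ) : ℝ) * (13 / 10 : ℝ) = ((13 : ℕ) : ℝ) by norm_num, Real.rpow_natCast]
  calc (q : ℝ) ^ (13 / 10 : ℝ) ≤ (C : ℝ) ^ (13 / 10 : ℝ) * (x : ℝ) ^ 13 := h4 ▸ h3
    _ ≤ (C : ℝ) ^ (13 / 10 : ℝ) * V := by gcongr

/-- **Tangency sets of size `p^{13/10}` for `p ≡ 1 (mod 11)` (Pohoata 2026, Thm 1.3 at `r = 11`, kernel-checked).**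
For every prime `p ≡ 1 (mod 11)` with `p > 7023·138⁵` the affine plane over `ZMod p` contains a tangency set `V`
(every `v ∈ V` lies on a line `{w : u ⬝ᵥ w = u ⬝ᵥ v}`, `u ≠ 0`, meeting `V` only in `v`) with
`p^{13/10} ≤ (1024·7023·138⁵)^{13/10} · |V|`.  Construction: the trace-zero lift of `ℤ[2cos(2π/11)]` through the
ring map given by `exists_eval₂_minpoly_eq_zero`, with `M = 2^k` maximal subject to `7023·138⁵·M¹⁰ < p`, `L = M²`,
`|V| = M¹³` (`exists_tangencySet_traceLift`). [cite: Pohoata2026SharpExponentMinimalDistance, Thm. 1.3] -/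
theorem exists_tangencySet_card_ge (hmod : p % 11 = 1) (hbig : 7023 * 138 ^ 5 < p) :
    ∃ V : Finset (Fin 2 → ZMod p),
      (p : ℝ) ^ (13 / 10 : ℝ) ≤ ((1024 * (7023 * 138 ^ 5) : ℕ) : ℝ) ^ (13 / 10 : ℝ) * V.card ∧
      ∀ v ∈ V, ∃ u : Fin 2 → ZMod p, u ≠ 0 ∧ ∀ w ∈ V, u ⬝ᵥ w = u ⬝ᵥ v → w = v := by
  obtain ⟨θ, hθ⟩ := exists_eval₂_minpoly_eq_zero hmod
  set g : AdjoinRoot (X ^ 5 + X ^ 4 - 4 * X ^ 3 - 3 * X ^ 2 + 3 * X + 1 : ℤ[X]) →+* ZMod p := AdjoinRoot.lift (Int.castRingHom (ZMod p)) θ hθ with hg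
  -- parameters
  set C : ℕ := 7023 * 138 ^ 5 with hC
  have hC0 : 0 < C := by rw [hC]; norm_num
  set k := Nat.log 1024 ((p - 1) / C) with hk
  set M := 2 ^ k with hM
  have hM10 : M ^ 10 = 1024 ^ k := by rw [hM, ← pow_mul, mul_comm, pow_mul]; norm_num
  have hne : (p - 1) / C ≠ 0 := by
    intro h0
    have := Nat.div_add_mod (p - 1) C
    have := Nat.mod_lt (p - 1) hC0
    omega
  have h1 : 1024 ^ k ≤ (p - 1) / C := Nat.pow_log_le_self _ hne
  have h2 : (p - 1) / C < 1024 ^ (k + 1) := Nat.lt_pow_succ_log_self (by norm_num) _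
  have hdm := Nat.div_add_mod (p - 1) C
  have hml := Nat.mod_lt (p - 1) hC0
  have hCM : C * M ^ 10 < p := by
    rw [hM10]
    have h5 : C * 1024 ^ k ≤ C * ((p - 1) / C) := Nat.mul_le_mul_left C h1
    calc C * 1024 ^ k ≤ C * ((p - 1) / C) := h5
      _ ≤ C * ((p - 1) / C) + (p - 1) % C := Nat.le_add_right _ _
      _ = p - 1 := hdm
      _ < p := by have := (Fact.out : p.Prime).two_le; omega
  have hpM : p ≤ 1024 * C * M ^ 10 := by
    have e : 1024 ^ (k + 1) = 1024 * M ^ 10 := by rw [pow_succ, hM10, mul_comm]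
    rw [e] at h2
    have h5 : C * ((p - 1) / C + 1) ≤ C * (1024 * M ^ 10) := Nat.mul_le_mul_left C h2
    have h6 : p = C * ((p - 1) / C) + (p - 1) % C + 1 := by
      have := (Fact.out : p.Prime).two_le; omega
    calc p = C * ((p - 1) / C) + (p - 1) % C + 1 := h6
      _ ≤ C * ((p - 1) / C) + C := by omega
      _ = C * ((p - 1) / C + 1) := by ring
      _ ≤ C * (1024 * M ^ 10) := h5
      _ = 1024 * C * M ^ 10 := by ring
  -- the size hypothesis of the lift with `L = M²`
  have hp' : 7023 * (39 * ((M ^ 2 : ℕ) : ℤ) + 99 * (M : ℤ) ^ 2) ^ 5 < p := by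
    have h := hCM
    rw [hC] at h
    have h' : ((7023 * 138 ^ 5 * M ^ 10 : ℕ) : ℤ) < p := by exact_mod_cast h
    push_cast at h' ⊢
    have e : (7023 : ℤ) * (39 * (M : ℤ) ^ 2 + 99 * (M : ℤ) ^ 2) ^ 5 = 7023 * 138 ^ 5 * (M : ℤ) ^ 10 := by ring
    rw [e]
    exact h'
  obtain ⟨V, hV, htan⟩ := exists_tangencySet_traceLift g (M ^ 2) M hp'
  refine ⟨V, ?_, htan⟩
  have hV13 : M ^ 13 ≤ V.card := by rw [hV]; ring_nf; exact le_rfl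
  exact rpow_thirteen_tenths_le hV13 (by simpa [hC, mul_assoc] using hpM)

/-- **The stub's format at exponent `13/10` (unconditional; Pohoata's theorem for `r = 11`).**  There is `c > 0`
such that for every `p₀` some prime `p ≥ p₀` (any prime `p ≡ 1 (mod 11)` beyond `7023·138⁵`) carries a strong
representative system of `AG(2,p)` in the exact flag format of `stub_tangencySets` with at least `c·p^{13/10}`
flags — exponent `1.3`, beyond `5/4`; the stub asks for `3/2`. [cite: Pohoata2026SharpExponentMinimalDistance,
Thm. 1.3] -/
theorem stubFormat_exponent_thirteen_tenths :
    ∃ c : ℝ, 0 < c ∧ ∀ p₀ : ℕ, ∃ (p : ℕ) (_ : Fact p.Prime), p₀ ≤ p ∧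
      ∃ S : Finset ((Fin 2 → ZMod p) × (Fin 2 → ZMod p)),
        c * (p : ℝ) ^ (13 / 10 : ℝ) ≤ S.card ∧
        ∀ f ∈ S, ∀ f' ∈ S, (dotProduct f.1 f'.2 = 1 ↔ f = f') := by
  classical
  refine ⟨1 / (2 * ((1024 * (7023 * 138 ^ 5) : ℕ) : ℝ) ^ (13 / 10 : ℝ)), by positivity, fun p₀ => ?_⟩
  obtain ⟨p, hp, hlt, hpmod⟩ := Nat.exists_prime_gt_modEq_one (max p₀ (7023 * 138 ^ 5)) (by norm_num : (11 : ℕ) ≠ 0)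
  haveI : Fact p.Prime := ⟨hp⟩
  have hp₀ : p₀ ≤ p := le_of_lt (lt_of_le_of_lt (le_max_left _ _) hlt)
  have hbig : 7023 * 138 ^ 5 < p := lt_of_le_of_lt (le_max_right _ _) hlt
  have hmod : p % 11 = 1 := by
    have h1 : p % 11 = 1 % 11 := hpmod
    simpa using h1
  obtain ⟨V, hV, htan⟩ := exists_tangencySet_card_ge hmod hbig
  choose! u hu using htan
  obtain ⟨S, hS, hsrs⟩ := FlagLine.TangencyHermitian.srs_of_tangencySet V u (fun v hv => (hu v hv).1)
    (fun v hv => (hu v hv).2)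
  refine ⟨p, ⟨hp⟩, hp₀, S, ?_, hsrs⟩
  have hp2 : (2 : ℝ) ≤ p := by exact_mod_cast hp.two_le
  have hS' : (V.card : ℝ) * p ≤ S.card * p + V.card := by
    rw [ZMod.card] at hS
    exact_mod_cast hS
  have hSV : (V.card : ℝ) ≤ 2 * S.card := by nlinarith
  have hc0 : (0 : ℝ) < ((1024 * (7023 * 138 ^ 5) : ℕ) : ℝ) ^ (13 / 10 : ℝ) := by positivity
  rw [div_mul_eq_mul_div, one_mul, div_le_iff₀ (by positivity)]
  nlinarith

end Summit.MatrixMultiplication.MatrixMultiplication.Theorems.LevelOneGL2Designs.TraceLift
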